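import Summits.BirchSwinnertonDyer.BirchSwinnertonDyer.Theorems.BiquadraticEisensteinDescentManinDatumSupercuspidalCMInertCMModelsQuartic
import Summits.BirchSwinnertonDyer.BirchSwinnertonDyer.Theorems.BiquadraticEisensteinDescentManinDatumSupercuspidalCMInertThetaValueAssembly
import Literature.NumberTheory.EllipticCurves.QuarticTwistThetaDictionaryInert
import Literature.NumberTheory.EllipticCurves.NewformGaloisRepIntegralityProofs
import Mathlib.NumberTheory.GaussSum
import HarnessLib

set_option linter.dupNamespace false -- `Summit.BirchSwinnertonDyer.BirchSwinnertonDyer.Theorems.…` (summit = sub, D-0017)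
set_option autoImplicit false

/-!
# Crux `ManinDatumSupercuspidalCMInert` (stmt-BirchSwinnertonDyer-20111, BED r605), stub `stub_S7` (CM `j = 1728`, additive CM-inert `7`):
# the `f`-free MODEL-level odd `L`-values H₇ of `y² = x³ + Ax`, `7 ∣ A`, from ONE statement about Eisenstein–Kronecker numbers of the
# Gaussian lattice — the `7`-integrality T₇ of the `(·/7)₄^k`-weighted `7`-TORSION SUMS of `E₁*` (width seat `bsd-wall-cm-bed-w2` g10;
# theorems only; route-independent imports; `--supports 20111`, helper)

Route `BiquadraticEisensteinDescent` (cell `pub/bsd-wall`, D-0152 M1). END-TO-END composition of the 2026-08-28 width wave on crux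
R₅₇-supercuspidal (`j = 1728` cell), all tree theorems, NO named fact:
  registered `stub_S7` ⟸ (bed-w4 g10, pointwise tame-twist lever p634645) plain `7`-integrality of the odd twisted symbol sums of `W`
  ⟸ (this seat, F2 p635902 `stub_S7_of_modelOddLValues`: fourth-power-free quartic model with `v₇(u_C) = 0`, transport, Birch) H₇ = `f`-free
  odd `L`-values of the models `E_A = y² = x³ + Ax`, `7 ∣ A` ⟸ (bed-w3 g9, inert theta dictionary p635899
  `QuarticTwist.lSeries_twist_eq_thetaLFunction_inert`: `Σ χ̄(n)a_n(E_A)n⁻ˢ = ¼·Θ-L_{7M′}(conj((·/7)₄)^k·Ψ)`, `k = v₇(A)`) ∧ (this seat,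
  generic assembly p636292 `…ThetaValueAssembly.oddLValue_quartic_of_dictionary_of_torsionIntegral`: CRT `ℤ[i]/7M′`, finite formula,
  period bookkeeping `7^{k/4}·7^{(4−k)/4} = 7`) **T₇** — the torsion hypothesis below.

* `H7_of_torsionIntegral` — H₇ (the hypothesis of `stub_S7_of_modelOddLValues`, verbatim) from **T₇**:
  for `k ∈ {1, 2, 3}`, every `M′` coprime to `7`, every integer `α` prime to `7` and every `w ∈ ℂ` with `M′w ∈ Λ = ℤi + ℤ`:
  `s · (Σ_{a mod 7} conj((a/7)₄)^k · E₁*(w + α·conj(a)/7)) / (ϖ₀ · 7^{(4−k)/4}) ∈ ℤ̄` for some `7 ∤ s`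
  (`(·/7)₄ = quarticCharMod 7`, bed-w3 g9's `GaussianQuarticCharMod`; `ϖ₀ = Γ(1/4)²/(2√(2π))`; canonical representatives `rep 7 a 0`).
* the REGISTERED SIGNATURE of `stub_S7` from T₇ alone is the one-line composition with F2's `stub_S7_of_modelOddLValues`, filed in the
  companion `…CMInertStubS7OfTorsionIntegral` (kept separate so that THIS file stays outside the route file's import cone).

WHY T₇ IS THE HONEST CORE (and why it is not proved here): at `q = 3` the analogous sums are CLOSED FORMS (bed-w1 g7 `quarticSum_eq`, deficits
`3^{3/4}, 3^{1/2}, 3^{1/4}` attained) because the ray class field of conductor `3` over `ℚ(i)` is `ℚ(ζ₁₂)`; at `q = 7` the `48` seven-division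
values generate the degree-`12` ray class field and no closed form is in reach. The structural proof of T₇ is a TAME RESOLVENT COUNT in the
Lubin–Tate extension `ℚ₄₉(E[7])/ℚ₄₉` of `y² = x³ − x` (`E₁*`-sum = `y(w)·Σ_a χ^k(a)/(x(w)² − x(a)²)`-type expression by the addition law;
`1/x(a)` has valuation `1/24` — reversed `7`-division polynomial is `7`-Eisenstein since `7` is supersingular; the `χ₇^{∓k} = ω^{48∓12k}`-isotypic
part of the valuation ring has valuation `≥ (48 − 12k)/48 = 1 − k/4`), which needs a torsion-valuation toolkit the tree does not have.
HONEST FRAMING: T₇ is NOT proved; nothing here proves the stub, the crux, Manin's conjecture or BSD. No definition, no named fact, no `sorry`.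
-/

noncomputable section

open scoped Classical ComplexConjugate

open Complex PeriodPair WeierstrassCurve IsDedekindDomain NumberField
open Literature.NumberTheory.EllipticCurves Literature.NumberTheory.EllipticCurves.GaussianLattice
open Literature.NumberTheory.LFunctions Literature.NumberTheory.LFunctions.GaussianTheta
open Literature.NumberTheory.QuadraticFields.GaussianQuarticSymbol
open Literature.NumberTheory.EllipticCurves.ModularForms

namespace Summit.BirchSwinnertonDyer.BirchSwinnertonDyer.Theorems.BiquadraticEisensteinDescentManinDatumSupercuspidalCMInertModelLValuesOfTorsionIntegral

open Summit.BirchSwinnertonDyer.BirchSwinnertonDyer.Theorems.BiquadraticEisensteinDescentManinDatumSupercuspidalCMInertCMModelsQuartic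
  (one_le_padicValInt_quartic)
open Summit.BirchSwinnertonDyer.BirchSwinnertonDyer.Theorems.BiquadraticEisensteinDescentManinDatumSupercuspidalCMInertThetaValueAssembly
  (oddLValue_quartic_of_dictionary_of_torsionIntegral)

/-- **H₇ from T₇.** The `f`-free MODEL-level odd twisted-value `7`-integrality (hypothesis H₇ of `stub_S7_of_modelOddLValues`, verbatim: every
fourth-power-free `A ≠ 0` with `7 ∣ A`, every prime `ℓ ≠ 2` with `ℓ ∤ A`, `ℓ ≡ 3 (4)`, `ℓ ≢ 1 (7)`, `ℓ ≢ 1 (3)`, `7` a square mod `ℓ`, every odd `χ`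
mod `ℓ`) follows from the `7`-integrality T₇ of the `conj((·/7)₄)^k`-weighted `7`-torsion sums of `E₁*` at the division points of order prime
to `7` (`k = 1, 2, 3`). Chain: `k := v₇(A) ∈ {1,2,3}` (`one_le_padicValInt_quartic`), `|A| = 7^k·A₁`; inert theta dictionary at `q = 7` for the
weight `χ̄` (bed-w3 g9 `QuarticTwist.lSeries_twist_eq_thetaLFunction_inert`, `ℓ ≠ 7` as `ℓ ∤ A`); periodicity of `(·/7)₄`
(`quarticCharMod_add_mul`); `…ThetaValueAssembly.oddLValue_quartic_of_dictionary_of_torsionIntegral` at `q = 7`. The congruence conditions on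
`ℓ` and the parity of `χ` are idle (the dictionary and T₇ serve every `ℓ ∤ 14A` and every `χ`).
[cite: Rubin1999, Prop. 7.15] [cite: IrelandRosen1982, Ch. 18 §4 Thm. 5 and §7] -/
theorem H7_of_torsionIntegral
    (hT : ∀ (k : ℕ), 1 ≤ k → k ≤ 3 → ∀ (M' : ℕ) [NeZero M'], Nat.Coprime 7 M' →
      ∀ (α : ℤ), ¬ (7 : ℤ) ∣ α → ∀ (w : ℂ), (M' : ℂ) * w ∈ (ofUpperHalfPlane UpperHalfPlane.I).lattice →
      ∃ s : ℕ, ¬ 7 ∣ s ∧ IsIntegral ℤ ((s : ℂ) *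
        (∑ a : ZMod 7 × ZMod 7, (conj (((quarticCharMod 7 (rep 7 a 0) : GaussianInt) : ℂ))) ^ k *
            kroneckerE₁ (w + (α : ℂ) * conj ((rep 7 a 0 : GaussianInt) : ℂ) / 7)) /
          ((((Real.Gamma (1 / 4) ^ 2 / (2 * Real.sqrt (2 * Real.pi))) : ℝ) : ℂ) * (7 : ℂ) ^ (((4 - k : ℕ) : ℂ) / 4)))) :
    ∀ (A : ℤ), A ≠ 0 → (7 : ℤ) ∣ A → (∀ q : ℕ, q.Prime → ¬ ((q : ℤ) ^ 4 ∣ A)) →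
      ∀ (ℓ : ℕ) [NeZero ℓ], ℓ.Prime → ℓ ≠ 2 → ¬ (ℓ : ℤ) ∣ A → ¬ 4 ∣ ℓ - 1 → ¬ 7 ∣ ℓ - 1 → ¬ 3 ∣ ℓ - 1 →
        IsSquare ((7 : ℕ) : ZMod ℓ) →
      ∀ χ : DirichletCharacter ℂ ℓ, χ.Odd →
      ∃ L : ℂ → ℂ, Differentiable ℂ L ∧
        (∀ s : ℂ, 2 < s.re → L s = LSeries (fun n : ℕ ↦ χ⁻¹ (n : ZMod ℓ) *
          ((⟨0, 0, 0, (A : ℚ), 0⟩ : WeierstrassCurve ℚ).LFunction n : ℂ)) s) ∧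
        ∃ s : ℕ, ¬ 7 ∣ s ∧ IsIntegral ℤ ((s : ℂ) * (gaussSum χ (ZMod.stdAddChar (N := ℓ)) * L 1 /
          (Complex.I * ((⟨0, 0, 0, (A : ℚ), 0⟩ : WeierstrassCurve ℚ).imaginaryPeriodRat : ℂ)))) := by
  intro A hA0 h7A h4 ℓ _ hℓ _hℓ2 hℓA _h4ℓ _h7ℓ _h3ℓ _hsq χ _hχ
  haveI : Fact (Nat.Prime 7) := ⟨by norm_num⟩
  -- `k = v₇(A) ∈ {1, 2, 3}`, `|A| = 7^k · A₁`
  set k : ℕ := padicValInt 7 A with hk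
  obtain ⟨hk1, hk3⟩ := one_le_padicValInt_quartic (p := 7) hA0 h7A (h4 7 (by norm_num))
  obtain ⟨c, hc⟩ : ((7 : ℕ) : ℤ) ^ k ∣ A := padicValInt_dvd A
  have hkA : A.natAbs = 7 ^ k * c.natAbs := by
    rw [hc, Int.natAbs_mul, Int.natAbs_pow]; rfl
  -- `ℓ ≠ 7` (as `ℓ ∤ A`, `7 ∣ A`)
  have h7ℓ : ¬ 7 ∣ ℓ := by
    intro h
    have h7 : ℓ = 7 := ((Nat.prime_dvd_prime_iff_eq (by norm_num) hℓ).mp h).symm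
    subst h7
    exact hℓA h7A
  -- the inert theta dictionary at `q = 7` for the weight `χ̄`
  obtain ⟨M', _, _, Ψ, hcop, hΨ, hΨint, hdict⟩ :=
    QuarticTwist.lSeries_twist_eq_thetaLFunction_inert (q := 7) (by norm_num) (by norm_num) hA0 h7A h4 (m := ℓ) h7ℓ
      (fun a : ZMod ℓ ↦ χ⁻¹ a) (fun a ↦ isIntegral_dirichletCharacter_apply χ⁻¹ a)
  -- periodicity of the weight `conj((·/7)₄)^k` modulo `7`
  have hΦ : ∀ x y : GaussianInt,
      (conj (((quarticCharMod 7 (x + 7 * y) : GaussianInt) : ℂ))) ^ (padicValInt 7 A) =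
        (conj (((quarticCharMod 7 x : GaussianInt) : ℂ))) ^ (padicValInt 7 A) := by
    intro x y
    have h := quarticCharMod_add_mul (7 : ℤ) x y
    push_cast at h
    rw [h]
  exact oddLValue_quartic_of_dictionary_of_torsionIntegral (q := 7) (by norm_num) A hA0 hk1 hk3 hkA χ hcop
    (fun x ↦ (conj (((quarticCharMod 7 x : GaussianInt) : ℂ))) ^ (padicValInt 7 A)) Ψ hΦ hΨ hΨint
    (fun s hs ↦ hdict s (by linarith)) (hT k hk1 hk3 M' hcop)

end Summit.BirchSwinnertonDyer.BirchSwinnertonDyer.Theorems.BiquadraticEisensteinDescentManinDatumSupercuspidalCMInertModelLValuesOfTorsionIntegral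

end
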